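import Literature.NumberTheory.EllipticCurves.Rank1Residual.Typed.WuthrichUpperBound
import HarnessLib

/-!
# Class X2 (Eisenstein multiplicative `p`) — TYPED missing input (cell `b2b-bsdres`)

HONEST FRAMING (run/shared/lean/b2b/bsd-rank1-residual/): construction-shaped classes are TYPED —
the missing local / Euler-system input is named and its required output at `(E,p)` stated — NOT
attempted; the cell deletes only the combination-shaped classes, from published theorems; this is
not "finishing BSD".

**Class X2** (RESIDUAL-CASES §a.2 v3; `Rank1Residual.ClassX2 W p := p ≠ 2 ∧ Red W p ∧ Mult W p`):
an odd prime `p ‖ N` at which `E[p]` is reducible (e.g. `30a1, 51a1, 66a1 @3`; `110a1@5`); both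
analytic ranks. Census v3: 236 pairs with `N < 2500` (148 of rank `0`, 88 of rank `1`), 496 with
`N < 10⁴`. Label: CONSTRUCTION-SHAPED.

**What kind of object is missing.** (r = 0) The Eisenstein-congruence direction of Mazur's
cyclotomic main conjecture at a MULTIPLICATIVE Eisenstein prime — `(L_p(E)) ⊆ char_Λ X(E/ℚ_∞)` (with
the trivial-zero factor at split `p`) for reducible `E[p]`, `p ‖ N` — equivalently the lower bound
`ord_p #Ш(E)_an ≤ ord_p #Ш(E)`; the Kato/Wuthrich direction is in print (below). (r = 1) In
addition an anticyclotomic CONTROL theorem with torsion and the Heegner-point-index step of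
Castella–Grossi–Skinner §§4–5 at a prime `p ‖ N` of the level — the "Eisenstein-prime analogue of
Castella 2018 / Skinner 2016 Thm. A at `p ‖ N`" (RESIDUAL-CASES §a.2 X2, missing piece).

**Closest published / announced results, verbatim.**
* Keller–Yin, arXiv:2402.12781v2 (PRE, unrefereed), Thm. 4 = anticyclotomic IMC for weight-2
  newforms at odd Eisenstein primes of semistable (multiplicative) reduction; the authors, p. 4:
  it "would yield a rank 1 BSD formula provided the results in [CGS] are extended to this setting"
  — the formula is NOT claimed (FLOOR R0.10/R1.10).
* Wuthrich, Doc. Math. 19 (2014), Thm. 16 (p. 397; p. 393 of the author's version): "Let `E/ℚ` be an elliptic curve and let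
  `p > 2` be a prime. Suppose that `E` has semi-stable reduction at `p` and that `E[p]` is reducible
  as a `G_ℚ`-module. Then `char_Λ X(E)` divides the ideal generated by `L_p(E)`. If the reduction
  of `E` is split multiplicative at `p`, then `I · char_Λ X(E)` divides the ideal generated by
  `L_p(E)`" (tree fact `Wuthrich2014.charIdeal_dvd_padicLFunction`, good ordinary case), and Prop. 21
  (p. 400): "`#Ш(E/ℚ)` divides `C · (L(E,1)/Ω_E⁺) · (#E(ℚ))²/∏_v c_v` where `C` is … only divisible
  by `2`, primes of additive reduction or primes for which the Galois representation on `E[p]` is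
  neither surjective nor contained in a Borel subgroup" (tree fact `Wuthrich2014.sha_dvd_analyticSha`)
  ⇒ at an X2 pair of analytic rank `0` the UPPER bound `ord_p #Ш ≤ ord_p #Ш_an` IS in print
  (`Typed.missingUpperBoundAt_of_wuthrich`), and `BSD(E,p)` follows per curve when `p ∤ #Ш_an`
  (lever L1 / proposed census row T-WU14: all 148 rank-0 window pairs).
* Greenberg–Vatsal, Invent. Math. 142 (2000) Thm. 1.3 and Castella–Grossi–Skinner, Math. Ann. 393
  (2025) Thm. 1 prove Mazur's main conjecture at Eisenstein primes of GOOD (ordinary) reduction only;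
  Skinner, Pacific J. Math. 283 (2016) Thm. A (IMC at `p ‖ N`) and Castella, Camb. J. Math. 6 (2018)
  Thm. A require `E[p]` IRREDUCIBLE.

**Why they do not reach X2.** Every published main-conjecture / control result at `p ‖ N` assumes
irreducible `E[p]`; every published Eisenstein-prime result assumes good reduction at `p`; the one
announced Eisenstein-multiplicative statement (KY Thm. 4) is an anticyclotomic IMC without the
control/index step, and is unrefereed.

This file: `X2.MissingInputAt` = (r = 0: the LOWER bound `ord_p #Ш_an ≤ ord_p #Ш` at `(E,p)`;
r = 1: the full missing output `MissingPPartAt W p`), and the conditional class theorem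
`X2.bsdp_of_missingInputAt` (r = 0 half supplied by Wuthrich's Prop. 21 through the named fact
`sha_dvd_analyticSha`). The universally quantified "for every X2 pair, `MissingInputAt`" is not a
Literature statement (no source proves it); it lives in the cell's CLASSES.md.
-/

noncomputable section

open scoped Classical

open WeierstrassCurve Literature.NumberTheory.EllipticCurves
  Literature.NumberTheory.EllipticCurves.Rank1Residual
  Literature.NumberTheory.EllipticCurves.Wuthrich2014

namespace Literature.NumberTheory.EllipticCurves.Rank1Residual.Typed

/-- **X2 — the missing input at `(E, p)`, typed.** For a pair of class X2 (odd multiplicative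
Eisenstein prime): in analytic rank `0`, the Eisenstein-congruence direction
`ord_p #Ш(E/ℚ)_an ≤ ord_p #Ш(E/ℚ)` (`MissingLowerBoundAt`; the opposite inequality is Wuthrich 2014
Prop. 21, in print); in analytic rank `1`, the whole `p`-part output `MissingPPartAt` (anticyclotomic
control with torsion + Heegner-index step at `p ‖ N` for reducible `E[p]`: not in print; Keller–Yin
2024 Thm. 4 gives only an anticyclotomic IMC, unrefereed). Nothing is asserted: this is the TYPE a
future theorem must inhabit at `(E,p)`. [cite: KellerYin2024, Thm. 4 and p. 4 ("provided the results in [CGS (shape only; nothing asserted)] are extended")] [cite: Wuthrich2014, Thm. 16 and Prop. 21 (shape only; nothing asserted)] -/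
def X2.MissingInputAt (W : WeierstrassCurve ℚ) (p : ℕ) : Prop :=
  (W.analyticRank = 0 → MissingLowerBoundAt W p) ∧ (W.analyticRank = 1 → MissingPPartAt W p)

/-- **X2 conditional class theorem.** For `E/ℚ` (globally minimal `W`) with `ord_{s=1} L(E,s) ≤ 1`
and `(E,p)` in class X2, the typed missing input at `(E,p)` yields Miller's `BSD(E,p)`; in analytic
rank `0` the published half is Wuthrich's Prop. 21 (`hW`; multiplicative ⇒ not additive, reducible
⇒ Borel image), with Gross–Zagier–Kolyvagin (`hGZK`) and modularity (`hmod`) as the standing named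
facts. [cite: Wuthrich2014, Prop. 21 (p. 400)] [cite: Miller2011LMS, §1 and Def. 1.1] -/
theorem X2.bsdp_of_missingInputAt (hW : sha_dvd_analyticSha)
    (hGZK : rank_eq_analyticRank_of_analyticRank_le_one) (hmod : hasEntireLFunction_rat)
    (W : WeierstrassCurve ℚ) [W.IsElliptic] [W.IsGloballyMinimal] (p : ℕ) [Fact p.Prime]
    (hr : W.analyticRank ≤ 1) (hX : ClassX2 W p) (hmiss : X2.MissingInputAt W p) : BSDp W p := by
  obtain ⟨hp, hred, hmult⟩ := hX
  rcases Nat.le_one_iff_eq_zero_or_eq_one.mp hr with h0 | h1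
  · have hadd : ¬ ((W.baseChange ℚ_[p]).minimal ℤ_[p]).HasAdditiveReduction ℤ_[p] :=
      WeierstrassCurve.HasMultiplicativeReduction.not_hasAdditiveReduction (R := ℤ_[p]) hmult
    exact bsdp_of_missingLowerBoundAt_of_wuthrich W p hW hGZK hmod hp h0 hadd (Or.inl hred)
      (hmiss.1 h0)
  · exact bsdp_of_missingPPartAt W p hGZK hr (hmiss.2 h1)

end Literature.NumberTheory.EllipticCurves.Rank1Residual.Typed
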